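import Summits.AtomisticToContinuum.BoseEinsteinCondensation.Theorems.BECConjugateDominationIMUChainGlueKernel
import Summits.AtomisticToContinuum.BoseEinsteinCondensation.Theorems.BECConjugateDominationIMUChainGlueLattice
import Mathlib.Analysis.Convex.Integral
import Mathlib.Analysis.SpecialFunctions.Log.Basic
import Mathlib.Analysis.Convex.SpecificFunctions.Basic
import HarnessLib

/-!
# Route `BECConjugateDomination`, glue `IMUChainGlue` (stmt-AtomisticToContinuum-11790) —
# helper: the Jensen–Parseval bound on the cell average of `log g`

Parseval on the cell in inner-product form (`∑ₙ conj(ĉₙ(φ)) ĉₙ(ψ) = L⁻³ ∫_cell conj(φ) ψ`, Mathlib's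
`UnitAddTorus.hasSum_prod_mFourierCoeff` transported like `hasSum_sq_cellFourierCoeff` of
`PeriodicBoseGasFourier`), and **steps (ii)–(iii)–(v) of the glue, abstractly.** Let `g > 0` be continuous on `ℝ³` with
`g ≥ θ > 0` within `4a` of every corner `Lε` of the cell (`4a ≤ L`), and suppose the Lévy weights
`νₙ = Re ĉₙ(log g)` satisfy `νₙ ≤ B₁ + B₂/‖n‖` for `n ≠ 0`.  Testing `log g` against the
positive-definite kernel `φ` of the `Kernel` file (Parseval on the cell, `ĉₙ(φ) = L⁻³|Eₙ|² ≥ 0`,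
`∫_cell φ = 1`, `φ = 0` where `g` is not controlled) gives
`L⁻³ ∫_cell log g = ∫_cell φ log g − ∑_{n≠0} |Eₙ|² νₙ ≥ log θ − (B₁ ∑|Eₙ|² + B₂ ∑_{n≠0} |Eₙ|²/‖n‖)`,
and the two Parseval sums of the `CornerSums` file with the lattice count of the `Lattice` file
bound the error by `B₁ · 8Q₀ L³/a³ + B₂ · (104 + 2Q₁/π²) L²/a²` (`Q₀ = ∫χ²`, `Q₁ = ∑ⱼ∫|∂ⱼχ|²`).
Jensen (`log` concave) then bounds the cell average of `g` from below by `θ e^{−error}`.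
-/

noncomputable section

open MeasureTheory Set Complex Filter
open scoped ENNReal NNReal Topology ComplexConjugate

namespace Summit.AtomisticToContinuum.BoseEinsteinCondensation.Theorems.IMUChainGlue

open Literature.MathematicalPhysics.QuantumManyBody.BoseGas

/-- The eight corners `{0,1}³ ⊂ ℤ³` (local notation, as in the `Corners` file). -/
local notation "corners" => (Fintype.piFinset fun _ : Fin 3 => ({0, 1} : Finset ℤ))

/-- The fixed profile (local notation, as in the `Bump` file). -/
local notation "χ" => (ContDiffBump.normed
  (ContDiffBump.mk 1 2 one_pos one_lt_two : ContDiffBump (0 : Space)) volume)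

/-- The scaled bump, value form (local notation, as in the `Bump` file). -/
local notation "ηv⟦" a ", " x "⟧" => (a ^ 3)⁻¹ * χ (a⁻¹ • x)

/-- The autocorrelation of the scaled bump (local notation, as in the `Kernel` file). -/
local notation "φ₀v⟦" a ", " s "⟧" => ∫ x : Space, ηv⟦a, x + s⟧ * ηv⟦a, x⟧

/-- `Q₀ = ∫ χ²` (local notation). -/
local notation "Q₀" => ∫ y : Space, (χ y) ^ 2

/-- `Q₁ = ∑ⱼ ∫ |∂ⱼχ|²` (local notation). -/
local notation "Q₁" => ∑ j : Fin 3, ∫ y : Space, (fderiv ℝ χ y (EuclideanSpace.single j 1)) ^ 2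

/-! ### Parseval on the cell, inner-product form -/

/-- **Parseval on the cell, inner-product form.** For continuous `φ, ψ : ℝ³ → ℂ`,
`∑ₙ conj(ĉₙ(φ)) ĉₙ(ψ) = L⁻³ ∫_{[0,L)³} conj(φ) ψ` (as a `HasSum`). -/
theorem hasSum_conj_cellFourierCoeff_mul {L : ℝ} (hL : 0 < L) {φ ψ : Space → ℂ}
    (hφ : Continuous φ) (hψ : Continuous ψ) :
    HasSum (fun n => conj (cellFourierCoeff L φ n) * cellFourierCoeff L ψ n)
      (((L ^ 3)⁻¹ : ℝ) • ∫ x in cell L, conj (φ x) * ψ x) := by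
  have hf := memLp_torusFun hL hφ
  have hg := memLp_torusFun hL hψ
  have hP := UnitAddTorus.hasSum_prod_mFourierCoeff (hf.toLp _) (hg.toLp _)
  have hcf : ∀ n, UnitAddTorus.mFourierCoeff (hf.toLp _ : UnitAddTorus (Fin 3) → ℂ) n =
      cellFourierCoeff L φ n := fun n =>
    integral_congr_ae (hf.coeFn_toLp.mono fun t ht => by simp only [ht])
  have hcg : ∀ n, UnitAddTorus.mFourierCoeff (hg.toLp _ : UnitAddTorus (Fin 3) → ℂ) n =
      cellFourierCoeff L ψ n := fun n =>
    integral_congr_ae (hg.coeFn_toLp.mono fun t ht => by simp only [ht])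
  rw [← integral_fromUnitTorus hL (fun x : Space => conj (φ x) * ψ x)]
  convert hP using 1
  · funext n
    rw [hcf, hcg]
  · exact integral_congr_ae ((hf.coeFn_toLp.and hg.coeFn_toLp).mono fun t ht => by
      simp only [ht.1, ht.2, torusFun])

/-- Transport of a `HasSum` along pointwise and value equalities. -/
theorem hasSum_congr_both {ι α : Type*} [AddCommMonoid α] [TopologicalSpace α] {f₁ f₂ : ι → α}
    {a₁ a₂ : α} (h : HasSum f₁ a₁) (hf : ∀ i, f₁ i = f₂ i) (ha : a₁ = a₂) : HasSum f₂ a₂ := by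
  subst ha
  exact h.congr_fun fun i => (hf i).symm

section

variable {L a θ B₁ B₂ : ℝ} {g : Space → ℝ}

/-- **The Lévy–Jensen–Parseval bound on the cell average of `log g`.** -/
theorem log_sub_le_setAverage_log (hL : 0 < L) (ha : 0 < a) (h4a : 4 * a ≤ L) (hθ : 0 < θ)
    (hB₁ : 0 ≤ B₁) (hB₂ : 0 ≤ B₂) (hg : Continuous g) (hpos : ∀ r, 0 < g r)
    (hnear : ∀ r : Space, (∃ ε ∈ corners, ‖r - latticeVec L ε‖ < 4 * a) → θ ≤ g r)
    (hν : ∀ n : Fin 3 → ℤ, n ≠ 0 →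
      (cellFourierCoeff L (fun r : Space => ((Real.log (g r) : ℝ) : ℂ)) n).re ≤
        B₁ + B₂ / ‖latticeVec 1 n‖) :
    Real.log θ - (B₁ * (8 * Q₀ * L ^ 3 / a ^ 3) + B₂ * ((104 + 2 * Q₁ / Real.pi ^ 2) * L ^ 2 / a ^ 2))
      ≤ (L ^ 3)⁻¹ * ∫ r in cell L, Real.log (g r) := by
  have h2a : 2 * a ≤ L := by linarith
  have h3a : 3 * a ≤ L := by linarith
  have haL : a ≤ L := by linarith
  -- the objects
  set ψ : Space → ℂ := fun r => ((Real.log (g r) : ℝ) : ℂ) with hψ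
  set E : (Fin 3 → ℤ) → ℂ := fun n => ∫ x, conj (cellWave L n x) * ((ηv⟦a, x⟧ : ℝ) : ℂ) with hE
  set c : (Fin 3 → ℤ) → ℝ := fun n => ‖E n‖ ^ 2 with hc
  set ν : (Fin 3 → ℤ) → ℝ := fun n => (cellFourierCoeff L ψ n).re with hνdef
  set φ : Space → ℝ := fun r => ∑ ε ∈ corners, φ₀v⟦a, r - latticeVec L ε⟧ with hφ
  have hψc : Continuous ψ := continuous_ofReal.comp (hg.log fun r => (hpos r).ne')
  have hφc : Continuous φ := continuous_kernel ha L
  have hc0 : ∀ n, 0 ≤ c n := fun n => sq_nonneg _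
  have hc1 : ∀ n, c n ≤ 1 := fun n => by
    have h := norm_integral_conj_cellWave_mul_bump_le ha L n
    rw [hc]
    nlinarith [norm_nonneg (E n)]
  have hcz : c 0 = 1 := by
    simp only [hc, hE, integral_conj_cellWave_zero_mul_bump ha L, norm_one, one_pow]
  -- Step 1: Parseval against the kernel, real parts, times `L³`
  have hP := hasSum_conj_cellFourierCoeff_mul hL (continuous_cornerSum L (continuous_autocorr ha)) hψc
  simp only [cellFourierCoeff_kernel hL ha h4a, Complex.conj_ofReal] at hP
  have hinner : ∫ r in cell L, conj (∑ ε ∈ corners, ((φ₀v⟦a, r - latticeVec L ε⟧ : ℝ) : ℂ)) * ψ r =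
      ((∫ r in cell L, φ r * Real.log (g r) : ℝ) : ℂ) := by
    rw [← integral_complex_ofReal]
    refine integral_congr_ae (Eventually.of_forall fun r => ?_)
    simp only [hψ, hφ, map_sum, Complex.conj_ofReal]
    push_cast
    ring
  rw [hinner] at hP
  have hL3 : (L ^ 3) ≠ 0 := by positivity
  have hT : HasSum (fun n => c n * ν n) (∫ r in cell L, φ r * Real.log (g r)) := by
    refine hasSum_congr_both ((hP.mapL Complex.reCLM).mul_left (L ^ 3)) (fun n => ?_) ?_
    · simp only [Complex.reCLM_apply, Complex.re_ofReal_mul, hc, hνdef, hE]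
      field_simp
    · simp only [Complex.reCLM_apply, Complex.real_smul, Complex.re_ofReal_mul, Complex.ofReal_re]
      field_simp
  -- Step 2: split off `n = 0`: `ν₀ = L⁻³ ∫ log g`, `c₀ = 1`
  have hν0 : ν 0 = (L ^ 3)⁻¹ * ∫ r in cell L, Real.log (g r) := by
    simp only [hνdef, cellFourierCoeff_zero hL, hψ, integral_complex_ofReal, Complex.real_smul,
      Complex.re_ofReal_mul, Complex.ofReal_re]
  classical
  have hR : HasSum (fun n => if n = 0 then 0 else c n * ν n)
      ((∫ r in cell L, φ r * Real.log (g r)) - ν 0) := by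
    have h := hT.update 0 0
    rw [hcz, one_mul, zero_sub, neg_add_eq_sub] at h
    refine h.congr_fun fun n => ?_
    by_cases hn : n = 0
    · subst hn; simp
    · simp [hn]
  -- Step 3: the kernel sees only the good region: `∫ φ log g ≥ log θ`
  have hmain : Real.log θ ≤ ∫ r in cell L, φ r * Real.log (g r) := by
    have hpt : ∀ r, φ r * Real.log θ ≤ φ r * Real.log (g r) := by
      intro r
      by_cases hr : φ r = 0
      · rw [hr, zero_mul, zero_mul]
      · exact mul_le_mul_of_nonneg_left (Real.log_le_log hθ (hnear r
          (exists_corner_of_kernel_ne_zero ha hr))) (kernel_nonneg ha L r)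
    calc Real.log θ = ∫ r in cell L, φ r * Real.log θ := by
          rw [integral_mul_const, setIntegral_kernel ha h4a, one_mul]
      _ ≤ ∫ r in cell L, φ r * Real.log (g r) :=
          setIntegral_mono_on (integrableOn_cell (hφc.mul continuous_const))
            (integrableOn_cell (hφc.mul (hg.log fun r => (hpos r).ne'))) (measurableSet_cell L)
            (fun r _ => hpt r)
  -- Step 4: the remainder is bounded by the two Parseval sums and the lattice count
  obtain ⟨S₀, hS₀, hS₀le⟩ := exists_hasSum_norm_sq_bumpCoeff hL ha h2a
  obtain ⟨S₁, hS₁, hS₁le⟩ := exists_hasSum_norm_sq_mul_norm_sq_bumpCoeff hL ha h3a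
  set M : ℕ := ⌈L / a⌉₊ with hM
  have hLa : 1 ≤ L / a := by rw [le_div_iff₀ ha]; linarith
  have hM1 : 1 ≤ M := Nat.one_le_iff_ne_zero.2 (Nat.ceil_pos.2 (by positivity)).ne'
  have hMle : (M : ℝ) ≤ 2 * (L / a) := by
    have := Nat.ceil_lt_add_one (by positivity : 0 ≤ L / a)
    rw [← hM] at this
    linarith
  have hMge : L / a ≤ (M : ℝ) := Nat.le_ceil _
  obtain ⟨hlsum, hlle⟩ := tsum_weight_div_norm_le hc0 hc1 hS₁ hM1
  have hmaj : HasSum (fun n => B₁ * c n + B₂ * (if n = 0 then 0 else c n / ‖latticeVec 1 n‖))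
      (B₁ * S₀ + B₂ * ∑' n, (if n = 0 then 0 else c n / ‖latticeVec 1 n‖)) :=
    (hS₀.mul_left B₁).add (hlsum.hasSum.mul_left B₂)
  have hRle : (∫ r in cell L, φ r * Real.log (g r)) - ν 0 ≤
      B₁ * S₀ + B₂ * ∑' n, (if n = 0 then 0 else c n / ‖latticeVec 1 n‖) := by
    refine hasSum_le (fun n => ?_) hR hmaj
    by_cases hn : n = 0
    · simp only [hn, ↓reduceIte, mul_zero, add_zero]
      exact mul_nonneg hB₁ (hc0 0)
    · simp only [hn, ↓reduceIte]
      have h := mul_le_mul_of_nonneg_left (hν n hn) (hc0 n)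
      calc c n * ν n ≤ c n * (B₁ + B₂ / ‖latticeVec 1 n‖) := h
        _ = B₁ * c n + B₂ * (c n / ‖latticeVec 1 n‖) := by ring
  -- Step 5: arithmetic of the cut-off `M = ⌈L/a⌉`
  have hS₁nn : 0 ≤ S₁ := hS₁.nonneg fun n => mul_nonneg (sq_nonneg _) (hc0 n)
  have hlat : ∑' n, (if n = 0 then 0 else c n / ‖latticeVec 1 n‖) ≤
      (104 + 2 * Q₁ / Real.pi ^ 2) * L ^ 2 / a ^ 2 := by
    refine hlle.trans ?_
    have hpi : 0 < Real.pi := Real.pi_pos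
    have h1 : 26 * (M : ℝ) ^ 2 ≤ 104 * L ^ 2 / a ^ 2 := by
      rw [le_div_iff₀ (by positivity)]
      have : (M : ℝ) * a ≤ 2 * L := by
        have := mul_le_mul_of_nonneg_right hMle ha.le
        rwa [mul_assoc, div_mul_cancel₀ _ ha.ne'] at this
      nlinarith [this, show (0:ℝ) ≤ M * a by positivity]
    have h2 : S₁ / (M : ℝ) ^ 3 ≤ (2 * Q₁ / Real.pi ^ 2) * L ^ 2 / a ^ 2 := by
      have hM3 : (L / a) ^ 3 ≤ (M : ℝ) ^ 3 := by gcongr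
      calc S₁ / (M : ℝ) ^ 3 ≤ S₁ / (L / a) ^ 3 := by gcongr
        _ ≤ ((L / (2 * Real.pi)) ^ 2 * (8 * L ^ 3 * ((a ^ 5)⁻¹ * Q₁))) / (L / a) ^ 3 := by
            gcongr
        _ = (2 * Q₁ / Real.pi ^ 2) * L ^ 2 / a ^ 2 := by
            field_simp
            ring
    calc 26 * (M : ℝ) ^ 2 + S₁ / (M : ℝ) ^ 3
        ≤ 104 * L ^ 2 / a ^ 2 + (2 * Q₁ / Real.pi ^ 2) * L ^ 2 / a ^ 2 := add_le_add h1 h2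
      _ = (104 + 2 * Q₁ / Real.pi ^ 2) * L ^ 2 / a ^ 2 := by ring
  have hS₀' : B₁ * S₀ ≤ B₁ * (8 * Q₀ * L ^ 3 / a ^ 3) := by
    refine mul_le_mul_of_nonneg_left (hS₀le.trans (le_of_eq ?_)) hB₁
    field_simp
  have hfin := add_le_add hS₀' (mul_le_mul_of_nonneg_left hlat hB₂)
  rw [← hν0]
  linarith

/-- A continuous positive function is bounded below by a positive constant on the cell. -/
theorem exists_pos_le_on_cell (hL : 0 < L) (hg : Continuous g) (hpos : ∀ r, 0 < g r) :
    ∃ m : ℝ, 0 < m ∧ ∀ r ∈ cell L, m ≤ g r := by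
  obtain ⟨x₀, _, hmin⟩ := (isCompact_closedBox L).exists_isMinOn
    ⟨0, ⟨0, fun k _ => by simp [hL.le], rfl⟩⟩ hg.continuousOn
  exact ⟨g x₀, hpos x₀, fun r hr => hmin (cell_subset_closedBox L hr)⟩

/-- **Jensen on the cell** (`log` concave): `L⁻³ ∫_cell log g ≤ log (L⁻³ ∫_cell g)` for a
continuous positive `g`. -/
theorem setAverage_log_le_log_setAverage (hL : 0 < L) (hg : Continuous g) (hpos : ∀ r, 0 < g r) :
    (L ^ 3)⁻¹ * ∫ r in cell L, Real.log (g r) ≤ Real.log ((L ^ 3)⁻¹ * ∫ r in cell L, g r) := by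
  obtain ⟨m, hm, hmle⟩ := exists_pos_le_on_cell hL hg hpos
  have hvol : volume (cell L) = ENNReal.ofReal (L ^ 3) := by
    rw [volume_cell, ENNReal.ofReal_pow hL.le]
  have h0 : volume (cell L) ≠ 0 := by rw [hvol]; positivity
  have htop : volume (cell L) ≠ ⊤ := by rw [hvol]; exact ENNReal.ofReal_ne_top
  have hJ := ConcaveOn.le_map_set_average (μ := volume) (t := cell L) (f := g)
    ((strictConcaveOn_log_Ioi.concaveOn).subset (Set.Ici_subset_Ioi.2 hm) (convex_Ici m))
    (Real.continuousOn_log.mono fun x hx => ne_of_gt (lt_of_lt_of_le hm hx)) isClosed_Ici h0 htop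
    ((ae_restrict_iff' (measurableSet_cell L)).2 (Eventually.of_forall fun r hr => hmle r hr))
    (integrableOn_cell hg) (integrableOn_cell (hg.log fun r => (hpos r).ne'))
  have havg : ∀ f : Space → ℝ, ⨍ r in cell L, f r = (L ^ 3)⁻¹ * ∫ r in cell L, f r := by
    intro f
    rw [setAverage_eq, smul_eq_mul, Measure.real, hvol, ENNReal.toReal_ofReal (by positivity)]
  rwa [havg, havg] at hJ

/-- **The Lévy–Jensen–Parseval bound on the cell average of `g`**: under the hypotheses of
`log_sub_le_setAverage_log`, `θ · exp(−error) ≤ L⁻³ ∫_cell g`. -/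
theorem mul_exp_neg_le_setAverage (hL : 0 < L) (ha : 0 < a) (h4a : 4 * a ≤ L) (hθ : 0 < θ)
    (hB₁ : 0 ≤ B₁) (hB₂ : 0 ≤ B₂) (hg : Continuous g) (hpos : ∀ r, 0 < g r)
    (hnear : ∀ r : Space, (∃ ε ∈ corners, ‖r - latticeVec L ε‖ < 4 * a) → θ ≤ g r)
    (hν : ∀ n : Fin 3 → ℤ, n ≠ 0 →
      (cellFourierCoeff L (fun r : Space => ((Real.log (g r) : ℝ) : ℂ)) n).re ≤
        B₁ + B₂ / ‖latticeVec 1 n‖) :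
    θ * Real.exp (-(B₁ * (8 * Q₀ * L ^ 3 / a ^ 3) +
        B₂ * ((104 + 2 * Q₁ / Real.pi ^ 2) * L ^ 2 / a ^ 2))) ≤ (L ^ 3)⁻¹ * ∫ r in cell L, g r := by
  have h1 := log_sub_le_setAverage_log hL ha h4a hθ hB₁ hB₂ hg hpos hnear hν
  have h2 := setAverage_log_le_log_setAverage hL hg hpos
  obtain ⟨m, hm, hmle⟩ := exists_pos_le_on_cell hL hg hpos
  have havgpos : 0 < (L ^ 3)⁻¹ * ∫ r in cell L, g r := by
    refine mul_pos (by positivity) ?_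
    have hvol : volume (cell L) = ENNReal.ofReal (L ^ 3) := by
      rw [volume_cell, ENNReal.ofReal_pow hL.le]
    calc (0 : ℝ) < m * L ^ 3 := by positivity
      _ = ∫ _ in cell L, m := by
          rw [setIntegral_const, Measure.real, hvol, ENNReal.toReal_ofReal (by positivity),
            smul_eq_mul, mul_comm]
      _ ≤ ∫ r in cell L, g r := setIntegral_mono_on (integrableOn_cell continuous_const)
          (integrableOn_cell hg) (measurableSet_cell L) hmle
  rw [← Real.exp_log hθ, ← Real.exp_add, ← Real.exp_log havgpos]
  exact Real.exp_le_exp.2 (by linarith)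

end

end Summit.AtomisticToContinuum.BoseEinsteinCondensation.Theorems.IMUChainGlue

end
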